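import Summits.CriticalPhenomena.PercolationContinuityZ3.Theorems.SahiMasterFamilyPhiSymmetric

/-!
# Box + top + PAIRWISE-UNION inequalities do not give `Φ_k ≥ 0` for all `k`: the order-sixteen witness again

Unit `prim-masterthm-p4` (gen 16; crux anchor stmt-CriticalPhenomena-4575, helper work; memo
`run/shared/lean/prim/prim-masterthm/prim-masterthm-p4/P4-GEN16-REPORT.md` §4).  Companion of `…UCHullFour` (at `k = 4` the six pairwise-union
inequalities `β_S + β_T ≤ 1 + β_{S∪T}` suffice; at `k = 5` too, by the exact LP certificate kit j137555), `…UCCert` / `…UCCertFive` (`F^{UC}(k)`: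
ALL pairwise-covering inequalities) and `…PhiSymmetric` (the parity witness `f16`, `Φ_16(f16 ∘ card) < 0`).

* `f16_pairUnion` — the `F(16)` witness `β_S = (199/200)^{x(|S|)}` satisfies EVERY pairwise-union inequality (a finite check on the parity
  profile: the achievable exponent triples `(x_s, x_t, x_{|S∪T|})`, `triple_mem_goodTriples`, then `q^a + q^b ≤ 1 + q^c` in each of the 21 cases).
* **`not_pairUnion_phiSet_nonneg_sixteen`** — hence "`0 ≤ β ≤ 1`, `β_univ = 1`, `β_S + β_T ≤ 1 + β_{S∪T}` ⇒ `Φ_16(β) ≥ 0`" is FALSE: the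
  covering inequalities with `m ≥ 3` sets (the one-missing-face inequalities of `…PhiNotEvent`, violated by the witness) are essential in
  `F^{UC}(k)` for large `k`.
HONEST FRAMING: a negative result about a relaxation; `F^{UC}(k)` / `(UC-hull)_k` (k ≥ 6), (GH)_k = PC-k (k ≥ 8), Sahi's `C_k` and the master
theorem remain OPEN.  Axioms standard. [this work]
-/

namespace Summit.CriticalPhenomena.PercolationContinuityZ3.Theorems

namespace PhiSymmetric

open Finset
open PrincipalCapBeta (phiSet)

/-- The exponent triples `(x_s, x_t, x_u)` that occur for `max(s,t) ≤ u ≤ s + t`, `s,t,u ≤ 16` (21 of the 27; `decide`). [this work] -/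
theorem triple_mem_goodTriples : ∀ s t u : Fin 17, max (s : ℕ) t ≤ u → (u : ℕ) ≤ s + t →
    (symProfile s, symProfile t, symProfile u) ∈ ([(0,0,0), (0,1,0), (0,1,1), (0,2,0), (0,2,2), (1,0,0), (1,0,1), (1,1,0), (1,1,1), (1,1,2), (1,2,0), (1,2,1), (1,2,2),
   (2,0,0), (2,0,2), (2,1,0), (2,1,1), (2,1,2), (2,2,0), (2,2,1), (2,2,2)] : List (ℕ × ℕ × ℕ)) := by
  decide

/-- On the listed triples `q^a + q^b ≤ 1 + q^c` for `q = 199/200` (the tight case is `2q ≤ 1 + q²`). [this work] -/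
theorem pow_add_pow_le_of_mem {a b c : ℕ} (h : (a, b, c) ∈ ([(0,0,0), (0,1,0), (0,1,1), (0,2,0), (0,2,2), (1,0,0), (1,0,1), (1,1,0), (1,1,1), (1,1,2), (1,2,0), (1,2,1), (1,2,2),
   (2,0,0), (2,0,2), (2,1,0), (2,1,1), (2,1,2), (2,2,0), (2,2,1), (2,2,2)] : List (ℕ × ℕ × ℕ))) :
    (199 / 200 : ℝ) ^ a + (199 / 200 : ℝ) ^ b ≤ 1 + (199 / 200 : ℝ) ^ c := by
  simp only [List.mem_cons, Prod.mk.injEq, List.not_mem_nil, or_false] at h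
  rcases h with ⟨rfl, rfl, rfl⟩ | ⟨rfl, rfl, rfl⟩ | ⟨rfl, rfl, rfl⟩ | ⟨rfl, rfl, rfl⟩ | ⟨rfl, rfl, rfl⟩ | ⟨rfl, rfl, rfl⟩ |
    ⟨rfl, rfl, rfl⟩ | ⟨rfl, rfl, rfl⟩ | ⟨rfl, rfl, rfl⟩ | ⟨rfl, rfl, rfl⟩ | ⟨rfl, rfl, rfl⟩ | ⟨rfl, rfl, rfl⟩ | ⟨rfl, rfl, rfl⟩ |
    ⟨rfl, rfl, rfl⟩ | ⟨rfl, rfl, rfl⟩ | ⟨rfl, rfl, rfl⟩ | ⟨rfl, rfl, rfl⟩ | ⟨rfl, rfl, rfl⟩ | ⟨rfl, rfl, rfl⟩ | ⟨rfl, rfl, rfl⟩ |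
    ⟨rfl, rfl, rfl⟩ <;> norm_num

/-- **The `F(16)` witness satisfies every pairwise-union inequality** `β_S + β_T ≤ 1 + β_{S∪T}`. [this work] -/
theorem f16_pairUnion (S T : Finset (Fin 16)) : f16 S.card + f16 T.card ≤ 1 + f16 (S ∪ T).card := by
  have h1 : S.card ≤ (S ∪ T).card := card_le_card subset_union_left
  have h2 : T.card ≤ (S ∪ T).card := card_le_card subset_union_right
  have h3 : (S ∪ T).card ≤ S.card + T.card := card_union_le S T
  have h4 : (S ∪ T).card ≤ 16 := (card_le_univ _).trans (by rw [Fintype.card_fin])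
  have key := triple_mem_goodTriples ⟨S.card, by omega⟩ ⟨T.card, by omega⟩ ⟨(S ∪ T).card, by omega⟩
    (by simp only [max_le_iff]; exact ⟨h1, h2⟩) h3
  unfold f16
  exact pow_add_pow_le_of_mem key

/-- **Box + top + pairwise union ⇏ `Φ_16 ≥ 0`.**  The statement "every `β : 2^[16] → [0,1]` with `β_univ = 1` and all pairwise-union inequalities
has `Φ_16(β) ≥ 0`" is false (witness `β_S = (199/200)^{x(|S|)}`, `Φ_16 ≈ −2.975·10^5`).  Contrast: it is TRUE at `k = 4` (`…UCHullFour`), and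
`F^{UC}(5)` (all pairwise-covering inequalities) holds (`…UCCertFive`). [this work] -/
theorem not_pairUnion_phiSet_nonneg_sixteen :
    ¬ (∀ β : Finset (Fin 16) → ℝ, (∀ B, 0 ≤ β B) → (∀ B, β B ≤ 1) → β univ = 1 →
      (∀ S T : Finset (Fin 16), β S + β T ≤ 1 + β (S ∪ T)) → 0 ≤ phiSet 16 β) := by
  intro h
  have hβ := h (fun S : Finset (Fin 16) => f16 S.card) (fun B => f16_nonneg _) (fun B => f16_le_one _) f16_univ f16_pairUnion
  have hfold : phiSet 16 (fun S : Finset (Fin 16) => f16 S.card) = phiSym f16 16 := rfl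
  rw [hfold, phiSym_f16_sixteen] at hβ
  norm_num at hβ

/-- The witness in words: a point of the box with top value one satisfying all pairwise-union inequalities and `Φ_16 < 0`. [this work] -/
theorem exists_pairUnion_phiSet_neg : ∃ β : Finset (Fin 16) → ℝ, (∀ B, 0 ≤ β B) ∧ (∀ B, β B ≤ 1) ∧ β univ = 1 ∧
    (∀ S T : Finset (Fin 16), β S + β T ≤ 1 + β (S ∪ T)) ∧ phiSet 16 β < 0 := by
  refine ⟨fun S => f16 S.card, fun B => f16_nonneg _, fun B => f16_le_one _, f16_univ, f16_pairUnion, ?_⟩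
  have hfold : phiSet 16 (fun S : Finset (Fin 16) => f16 S.card) = phiSym f16 16 := rfl
  rw [hfold, phiSym_f16_sixteen]
  norm_num

end PhiSymmetric

end Summit.CriticalPhenomena.PercolationContinuityZ3.Theorems
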